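/-
Copyright: cell pub-balaban-gaps, seat ne8 (estimate NE7c), gen 14. Project licence.
-/
import Summits.QuantumFields.BalabanUV.T4Continuum.Spine.NE7b.CompactFibreHalvedActionSUN

/-!
# Road (δ) on the windowed Boltzmann weight in PRINT'S REGIME: the live factor on the restricted one-plaquette partition function
# `z_β(t) = ∫_{Re tr(1−V) ≤ t} e^{−β·Re tr(1−V)} dHaar` costs at most `e^{−βνt∕2} ∕ Haar(W_{νt∕2})` — EXPONENTIALLY SMALL in `β·t`, all `N`,
# no doubling needed — so the integrated currency is FREE when the Gaussian width `β⁻¹` sits inside the lowered window (row 47 (ii) QUANTIFIED),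
# and `½d(𝔤)·log ν⁻¹` at worst (file 32) (row NE7c; junction J-17, Laplace half)

Cell `pub-balaban-gaps` (G2), seat ne8, estimate **NE7c** (`T4IndicatorShell.ShellWeightBound`; two-run artefact, NOT PRINTED in
[Bałaban 1983–89], NOT PROVED).  Proof-only file under `Spine/NE7c/`: imports seat ne6's V38 `Spine/NE7b/CompactFibreHalvedActionSUN` only
(for the measurability of the deficit `Re tr(1 − V)` and of its windows; its nonnegativity — V35's `re_trace_one_sub_nonneg` — is inlined as a `have`, that module's olean being unbuilt); Mathlib otherwise.  Nothing of Bałaban's is named; no `def`;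
0 `sorry`.

THE QUESTION (seat census `HOME/ne/NE7c.md` §21, row 48 (v)).  File 32 (`LiveFactorWindowBoltzmann`) prices the live factor on the restricted
partition function at `(3∕2)·log ν⁻¹` per plaquette variable for EVERY `β ≥ 0` (doubling); file 27 §4 found print's profile letter FREE below
the nesting clause `σ ≤ ν₀η` (Gaussian width inside the lowered window).  What is the live loss AS A FUNCTION OF `β`, and how do the two
readings interpolate?

ANSWER ([folklore] Laplace-type bound; no doubling, every `N`): for `0 < ν ≤ 1`, `t ≥ 0`, `β ≥ 0`,
`z_β(t) ≤ z_β(νt)·(1 + e^{−βνt∕2} ∕ Haar(W_{νt∕2}))`, hence `0 ≤ −log z_β(νt) − (−log z_β(t)) ≤ e^{−βνt∕2} ∕ Haar(W_{νt∕2})`.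
* §1 ABSTRACT (finite measure space, deficit `s ≥ 0` measurable, windows `{s ≤ u}`, `z(u) = ∫_{s≤u} e^{−βs}`): `setIntegral_window_mono`
  (`z` is monotone in the level), `setIntegral_window_le_add` (`z(b) ≤ z(a) + e^{−βa}·μ(univ)` for `a ≤ b`: the shell `a < s ≤ b` weighs at most
  `e^{−βa}`), `setIntegral_window_ge` (`e^{−βc}·μ{s ≤ c} ≤ z(a)` for `c ≤ a`), **`setIntegral_window_le_mul`** (`z(b) ≤ z(a)·(1 +
  e^{−β(a−c)}·μ(univ)∕μ{s ≤ c})` for `c ≤ a ≤ b`, `μ{s ≤ c} > 0`), `neg_log_setIntegral_window_le` (log form, `log(1 + x) ≤ x`).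
* §2 `SU(N)`, ALL `N`: **`neg_log_windowedBoltzmann_live_le_laplace`** — for `β ≥ 0`, `0 < ν ≤ 1`, `t ≥ 0` and `Haar(W_{νt∕2}) > 0`:
  `−log z_β(νt) ≤ −log z_β(t) + e^{−βνt∕2} ∕ Haar_{SU(N)}(W_{νt∕2})`; `windowedBoltzmann_live_le` (the other side: `z_β(νt) ≤ z_β(t)`, the live
  integral is the smaller one — the upper use is FREE); **`tendsto_laplaceError_atTop`** (`e^{−βνt∕2} ∕ Haar(W_{νt∕2}) → 0` as `β → ∞` for
  `t > 0`): in the regime `β·t → ∞` the live factor on the integrated currency VANISHES.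
* §2b THE REGION (product Haar on `B → SU(N)`, `S = Σ_b Re tr(1 − v_b)`, window `Π_b W`): `setIntegral_pi_window_eq_pow` (Fubini:
  `∫_{Π W_t} e^{−βS} dκ = z_β(t)^{#B}`, Mathlib `restrict_pi_pi` + `integral_fintype_prod_eq_pow`), **`neg_log_windowedBoltzmann_pi_live_le_laplace`**
  (`−log ∫_{Π W_{νt}} e^{−βS} ≤ −log ∫_{Π W_t} e^{−βS} + #B·e^{−βνt∕2}∕Haar(W_{νt∕2})`).
* §3 sanity: at `ν = 1` the two restricted integrals coincide.

CENSUS (row 48 (v), NEW; `HOME/ne/NE7c.md` §21.1): the live loss on the INTEGRATED currency, relative to the unlowered letter, is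
`≤ min{ ½d(𝔤)·log ν⁻¹ + log D (file 32; β-uniform), e^{−βνt∕2} ∕ Haar(W_{νt∕2}) (this file; all N) }` per plaquette variable: FREE up to an
exponentially small error when the Gaussian width `β⁻¹` sits inside the lowered window (print's regime: `β·t = (window ∕ width)²` is a positive
power of `log g_k⁻²` — row 47 (ii) QUANTIFIED without the nesting-clause bookkeeping), and never worse than the volume currency's
`½d(𝔤)·log ν₀⁻¹`.  MILD; identical under every member of road (δ).  BY-NAME EFFECT ON THE WALL: none (junction ∕ census file).

NOT HERE (honest): general profiles; which `t(g_k)`, `β = g_k⁻²` Bałaban's step carries — ne6's (A3) ∕ (A1c) list applies verbatim (NC-NE7b-α UNRULED); node O;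
NE7c.  VERDICT WORD UNCHANGED: WORK-bound behind node O; INSTANCE 0∕1.  NE7c ∕ NE7b NOT PRINTED ∕ NOT PROVED; spine 0∕9; one finite T⁴
— NOT ℝ⁴, NOT infinite volume, NOT the mass gap, NOT Clay.
HONEST DEPENDENCY (cell): continuum YM on T⁴ ⇐ BetaPertH ∧ nine spine estimates (0∕9 proved); BetaPertH ⇐ (D1) ∧ (D4) ∧ CAP+tail.
-/

set_option autoImplicit false

noncomputable section

open MeasureTheory Real Filter Set Topology
open scoped Matrix.Norms.Frobenius
open Literature.MathematicalPhysics.QuantumFieldTheory (haarProbability)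
open Literature.MathematicalPhysics.QuantumFieldTheory.UnitaryCayley (re_trace_one_sub)
open Summit.QuantumFields.BalabanUV.T4Continuum.NE7b.CompactFibreHalvedActionSUN (measurable_re_trace_one_sub measurableSet_traceWindow)

namespace Summit.QuantumFields.BalabanUV.T4Continuum.Spine.NE7c.LiveFactorWindowLaplace

/-! ## §1 Abstract: the shell between two windows weighs at most `e^{−βa}`; the inner window weighs at least `e^{−βc}·μ{s ≤ c}` -/

section Abstract

variable {X : Type*} [MeasurableSpace X] (μ : Measure X) [IsFiniteMeasure μ]

/-- The windowed Boltzmann weight is integrable on any set (bounded by `1`, finite measure). [folklore] -/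
theorem integrableOn_exp_neg_mul {s : X → ℝ} (hs : Measurable s) (hs0 : ∀ x, 0 ≤ s x) {β : ℝ} (hβ : 0 ≤ β) (A : Set X) :
    IntegrableOn (fun x => Real.exp (-(β * s x))) A μ := by
  have hmeas : Measurable fun x => Real.exp (-(β * s x)) := Real.measurable_exp.comp ((hs.const_mul β).neg)
  exact (Integrable.of_bound (μ := μ) hmeas.aestronglyMeasurable 1 (ae_of_all _ fun x => by
    rw [Real.norm_eq_abs, abs_of_pos (Real.exp_pos _), Real.exp_le_one_iff]; nlinarith [hs0 x])).integrableOn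

/-- **THE LIVE INTEGRAL IS THE SMALLER ONE** (upper use FREE): `∫_{s ≤ a} e^{−βs} ≤ ∫_{s ≤ b} e^{−βs}` for `a ≤ b`. [folklore] -/
theorem setIntegral_window_mono {s : X → ℝ} (hs : Measurable s) (hs0 : ∀ x, 0 ≤ s x) {β : ℝ} (hβ : 0 ≤ β) {a b : ℝ} (hab : a ≤ b) :
    ∫ x in {x | s x ≤ a}, Real.exp (-(β * s x)) ∂μ ≤ ∫ x in {x | s x ≤ b}, Real.exp (-(β * s x)) ∂μ :=
  setIntegral_mono_set (integrableOn_exp_neg_mul μ hs hs0 hβ _) (ae_of_all _ fun _ => (Real.exp_pos _).le)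
    (ae_of_all _ fun x (hx : s x ≤ a) => show s x ≤ b from hx.trans hab)

/-- **THE SHELL WEIGHS AT MOST `e^{−βa}`**: `∫_{s ≤ b} e^{−βs} ≤ ∫_{s ≤ a} e^{−βs} + e^{−βa}·μ(univ)` for `a ≤ b`, `β ≥ 0`. [folklore] -/
theorem setIntegral_window_le_add {s : X → ℝ} (hs : Measurable s) (hs0 : ∀ x, 0 ≤ s x) {β : ℝ} (hβ : 0 ≤ β) {a b : ℝ} (hab : a ≤ b) :
    ∫ x in {x | s x ≤ b}, Real.exp (-(β * s x)) ∂μ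
      ≤ ∫ x in {x | s x ≤ a}, Real.exp (-(β * s x)) ∂μ + Real.exp (-(β * a)) * μ.real Set.univ := by
  have hmsW : ∀ u : ℝ, MeasurableSet {x | s x ≤ u} := fun u => measurableSet_le hs measurable_const
  have hsplit : {x | s x ≤ b} = {x | s x ≤ a} ∪ ({x | s x ≤ b} \ {x | s x ≤ a}) := by
    rw [Set.union_sdiff_cancel]; exact fun x (hx : s x ≤ a) => show s x ≤ b from hx.trans hab
  have hdisj : Disjoint {x | s x ≤ a} ({x | s x ≤ b} \ {x | s x ≤ a}) := Set.disjoint_sdiff_right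
  rw [hsplit, setIntegral_union hdisj ((hmsW b).diff (hmsW a)) (integrableOn_exp_neg_mul μ hs hs0 hβ _)
    (integrableOn_exp_neg_mul μ hs hs0 hβ _)]
  -- on the shell `s > a`, so the weight is `≤ e^{−βa}`
  have hshell : ∫ x in {x | s x ≤ b} \ {x | s x ≤ a}, Real.exp (-(β * s x)) ∂μ
      ≤ ∫ _ in {x | s x ≤ b} \ {x | s x ≤ a}, Real.exp (-(β * a)) ∂μ :=
    setIntegral_mono_on (integrableOn_exp_neg_mul μ hs hs0 hβ _) (integrableOn_const (measure_ne_top _ _))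
      ((hmsW b).diff (hmsW a)) fun x hx => by
        apply Real.exp_le_exp.2
        have hxa : a < s x := not_le.1 hx.2
        nlinarith
  have hconst : ∫ _ in {x | s x ≤ b} \ {x | s x ≤ a}, Real.exp (-(β * a)) ∂μ ≤ Real.exp (-(β * a)) * μ.real Set.univ := by
    rw [setIntegral_const, smul_eq_mul, mul_comm]
    exact mul_le_mul_of_nonneg_left (measureReal_mono (Set.subset_univ _) (measure_ne_top _ _)) (Real.exp_pos _).le
  linarith

/-- **THE INNER WINDOW WEIGHS AT LEAST `e^{−βc}·μ{s ≤ c}`**: for `c ≤ a`, `β ≥ 0`: `e^{−βc}·μ{s ≤ c} ≤ ∫_{s ≤ a} e^{−βs}`. [folklore] -/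
theorem setIntegral_window_ge {s : X → ℝ} (hs : Measurable s) (hs0 : ∀ x, 0 ≤ s x) {β : ℝ} (hβ : 0 ≤ β) {c a : ℝ} (hca : c ≤ a) :
    Real.exp (-(β * c)) * μ.real {x | s x ≤ c} ≤ ∫ x in {x | s x ≤ a}, Real.exp (-(β * s x)) ∂μ := by
  have hmsW : ∀ u : ℝ, MeasurableSet {x | s x ≤ u} := fun u => measurableSet_le hs measurable_const
  have h1 : Real.exp (-(β * c)) * μ.real {x | s x ≤ c} = ∫ _ in {x | s x ≤ c}, Real.exp (-(β * c)) ∂μ := by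
    rw [setIntegral_const, smul_eq_mul]; exact mul_comm _ _
  rw [h1]
  calc ∫ _ in {x | s x ≤ c}, Real.exp (-(β * c)) ∂μ ≤ ∫ x in {x | s x ≤ c}, Real.exp (-(β * s x)) ∂μ :=
        setIntegral_mono_on (integrableOn_const (measure_ne_top _ _)) (integrableOn_exp_neg_mul μ hs hs0 hβ _) (hmsW c)
          fun x (hx : s x ≤ c) => Real.exp_le_exp.2 (by nlinarith)
    _ ≤ ∫ x in {x | s x ≤ a}, Real.exp (-(β * s x)) ∂μ := setIntegral_window_mono μ hs hs0 hβ hca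

/-- **THE LAPLACE BOUND**: for `c ≤ a ≤ b`, `β ≥ 0` and `μ{s ≤ c} > 0`,
`∫_{s ≤ b} e^{−βs} ≤ (∫_{s ≤ a} e^{−βs})·(1 + e^{−β(a−c)}·μ(univ) ∕ μ{s ≤ c})`. [folklore] -/
theorem setIntegral_window_le_mul {s : X → ℝ} (hs : Measurable s) (hs0 : ∀ x, 0 ≤ s x) {β : ℝ} (hβ : 0 ≤ β) {c a b : ℝ}
    (hca : c ≤ a) (hab : a ≤ b) (hc : 0 < μ.real {x | s x ≤ c}) :
    ∫ x in {x | s x ≤ b}, Real.exp (-(β * s x)) ∂μ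
      ≤ (∫ x in {x | s x ≤ a}, Real.exp (-(β * s x)) ∂μ) * (1 + Real.exp (-(β * (a - c))) * μ.real Set.univ / μ.real {x | s x ≤ c}) := by
  have hza := setIntegral_window_ge μ hs hs0 hβ hca
  have hadd := setIntegral_window_le_add μ hs hs0 hβ hab
  have hec : 0 < Real.exp (-(β * c)) := Real.exp_pos _
  -- `e^{−βa}·M ≤ z(a)·e^{−β(a−c)}·M/μ{s≤c}` because `z(a) ≥ e^{−βc}μ{s≤c}`
  have hM : 0 ≤ μ.real Set.univ := measureReal_nonneg
  have hkey : Real.exp (-(β * a)) * μ.real Set.univ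
      ≤ (∫ x in {x | s x ≤ a}, Real.exp (-(β * s x)) ∂μ) * (Real.exp (-(β * (a - c))) * μ.real Set.univ / μ.real {x | s x ≤ c}) := by
    have hexp : Real.exp (-(β * a)) = Real.exp (-(β * c)) * Real.exp (-(β * (a - c))) := by
      rw [← Real.exp_add]; ring_nf
    rw [hexp]
    have h2 : Real.exp (-(β * c)) ≤ (∫ x in {x | s x ≤ a}, Real.exp (-(β * s x)) ∂μ) / μ.real {x | s x ≤ c} := by
      rw [le_div_iff₀ hc]; exact hza
    have h3 : 0 ≤ Real.exp (-(β * (a - c))) * μ.real Set.univ := mul_nonneg (Real.exp_pos _).le hM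
    calc Real.exp (-(β * c)) * Real.exp (-(β * (a - c))) * μ.real Set.univ
        = Real.exp (-(β * c)) * (Real.exp (-(β * (a - c))) * μ.real Set.univ) := by ring
      _ ≤ (∫ x in {x | s x ≤ a}, Real.exp (-(β * s x)) ∂μ) / μ.real {x | s x ≤ c} * (Real.exp (-(β * (a - c))) * μ.real Set.univ) :=
          mul_le_mul_of_nonneg_right h2 h3
      _ = _ := by ring
  calc ∫ x in {x | s x ≤ b}, Real.exp (-(β * s x)) ∂μ
      ≤ ∫ x in {x | s x ≤ a}, Real.exp (-(β * s x)) ∂μ + Real.exp (-(β * a)) * μ.real Set.univ := hadd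
    _ ≤ ∫ x in {x | s x ≤ a}, Real.exp (-(β * s x)) ∂μ
        + (∫ x in {x | s x ≤ a}, Real.exp (-(β * s x)) ∂μ) * (Real.exp (-(β * (a - c))) * μ.real Set.univ / μ.real {x | s x ≤ c}) :=
          by linarith
    _ = _ := by ring

/-- **LOG FORM**: for `c ≤ a ≤ b`, `β ≥ 0`, `μ{s ≤ c} > 0`: both restricted integrals are positive and
`−log ∫_{s ≤ a} e^{−βs} ≤ −log ∫_{s ≤ b} e^{−βs} + e^{−β(a−c)}·μ(univ) ∕ μ{s ≤ c}` (`log(1 + x) ≤ x`). [folklore] -/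
theorem neg_log_setIntegral_window_le {s : X → ℝ} (hs : Measurable s) (hs0 : ∀ x, 0 ≤ s x) {β : ℝ} (hβ : 0 ≤ β) {c a b : ℝ}
    (hca : c ≤ a) (hab : a ≤ b) (hc : 0 < μ.real {x | s x ≤ c}) :
    0 < ∫ x in {x | s x ≤ a}, Real.exp (-(β * s x)) ∂μ ∧
    -Real.log (∫ x in {x | s x ≤ a}, Real.exp (-(β * s x)) ∂μ)
      ≤ -Real.log (∫ x in {x | s x ≤ b}, Real.exp (-(β * s x)) ∂μ) + Real.exp (-(β * (a - c))) * μ.real Set.univ / μ.real {x | s x ≤ c} := by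
  have hza : 0 < ∫ x in {x | s x ≤ a}, Real.exp (-(β * s x)) ∂μ :=
    lt_of_lt_of_le (mul_pos (Real.exp_pos _) hc) (setIntegral_window_ge μ hs hs0 hβ hca)
  refine ⟨hza, ?_⟩
  set E : ℝ := Real.exp (-(β * (a - c))) * μ.real Set.univ / μ.real {x | s x ≤ c} with hE
  have hE0 : 0 ≤ E := div_nonneg (mul_nonneg (Real.exp_pos _).le measureReal_nonneg) hc.le
  have hmul := setIntegral_window_le_mul μ hs hs0 hβ hca hab hc
  have hzb : 0 < ∫ x in {x | s x ≤ b}, Real.exp (-(β * s x)) ∂μ := hza.trans_le (setIntegral_window_mono μ hs hs0 hβ hab)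
  have hlog := Real.log_le_log hzb hmul
  rw [Real.log_mul hza.ne' (by positivity)] at hlog
  have h1E : Real.log (1 + E) ≤ E := by
    have := Real.log_le_sub_one_of_pos (show 0 < 1 + E by positivity); linarith
  linarith

end Abstract

/-! ## §2 `SU(N)`, all `N`: the live factor on the restricted one-plaquette partition function in print's regime -/

section SUN

variable {N : ℕ}

/-- **THE LIVE RESTRICTED INTEGRAL IS THE SMALLER ONE** (`ν ≤ 1`, `t ≥ 0`): `z_β(νt) ≤ z_β(t)` — the upper use is FREE. [folklore] -/
theorem windowedBoltzmann_live_le {β ν t : ℝ} (hβ : 0 ≤ β) (hν1 : ν ≤ 1) (ht : 0 ≤ t) :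
    ∫ V in {V : Matrix.specialUnitaryGroup (Fin N) ℂ | (Matrix.trace (1 - (V : Matrix (Fin N) (Fin N) ℂ))).re ≤ ν * t},
        Real.exp (-(β * (Matrix.trace (1 - (V : Matrix (Fin N) (Fin N) ℂ))).re)) ∂(haarProbability (Matrix.specialUnitaryGroup (Fin N) ℂ))
      ≤ ∫ V in {V : Matrix.specialUnitaryGroup (Fin N) ℂ | (Matrix.trace (1 - (V : Matrix (Fin N) (Fin N) ℂ))).re ≤ t},
        Real.exp (-(β * (Matrix.trace (1 - (V : Matrix (Fin N) (Fin N) ℂ))).re)) ∂(haarProbability (Matrix.specialUnitaryGroup (Fin N) ℂ)) :=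
  setIntegral_window_mono _ measurable_re_trace_one_sub
    (fun V => by rw [re_trace_one_sub (Matrix.mem_specialUnitaryGroup_iff.1 V.2).1]; positivity) hβ (by nlinarith)

/-- **THE LIVE FACTOR ON THE RESTRICTED PARTITION FUNCTION IN PRINT'S REGIME, ALL `N`**: for `β ≥ 0`, `0 < ν ≤ 1`, `t ≥ 0` and
`Haar(W_{νt∕2}) > 0`: `z_β(νt) > 0` and `−log z_β(νt) ≤ −log z_β(t) + e^{−βνt∕2} ∕ Haar_{SU(N)}(W_{νt∕2})` — the loss is exponentially small in
`β·νt` (Gaussian width `β⁻¹` inside the lowered window), with NO doubling constant and NO rate. [folklore] -/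
theorem neg_log_windowedBoltzmann_live_le_laplace {β ν t : ℝ} (hβ : 0 ≤ β) (hν0 : 0 < ν) (hν1 : ν ≤ 1) (ht : 0 ≤ t)
    (hpos : 0 < (haarProbability (Matrix.specialUnitaryGroup (Fin N) ℂ)).real
        {V : Matrix.specialUnitaryGroup (Fin N) ℂ | (Matrix.trace (1 - (V : Matrix (Fin N) (Fin N) ℂ))).re ≤ ν * t / 2}) :
    0 < ∫ V in {V : Matrix.specialUnitaryGroup (Fin N) ℂ | (Matrix.trace (1 - (V : Matrix (Fin N) (Fin N) ℂ))).re ≤ ν * t},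
        Real.exp (-(β * (Matrix.trace (1 - (V : Matrix (Fin N) (Fin N) ℂ))).re)) ∂(haarProbability (Matrix.specialUnitaryGroup (Fin N) ℂ)) ∧
    -Real.log (∫ V in {V : Matrix.specialUnitaryGroup (Fin N) ℂ | (Matrix.trace (1 - (V : Matrix (Fin N) (Fin N) ℂ))).re ≤ ν * t},
        Real.exp (-(β * (Matrix.trace (1 - (V : Matrix (Fin N) (Fin N) ℂ))).re)) ∂(haarProbability (Matrix.specialUnitaryGroup (Fin N) ℂ)))
      ≤ -Real.log (∫ V in {V : Matrix.specialUnitaryGroup (Fin N) ℂ | (Matrix.trace (1 - (V : Matrix (Fin N) (Fin N) ℂ))).re ≤ t},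
        Real.exp (-(β * (Matrix.trace (1 - (V : Matrix (Fin N) (Fin N) ℂ))).re)) ∂(haarProbability (Matrix.specialUnitaryGroup (Fin N) ℂ)))
        + Real.exp (-(β * (ν * t / 2))) / (haarProbability (Matrix.specialUnitaryGroup (Fin N) ℂ)).real
          {V : Matrix.specialUnitaryGroup (Fin N) ℂ | (Matrix.trace (1 - (V : Matrix (Fin N) (Fin N) ℂ))).re ≤ ν * t / 2} := by
  have hνt : 0 ≤ ν * t := mul_nonneg hν0.le ht
  obtain ⟨hz, hle⟩ := neg_log_setIntegral_window_le (haarProbability (Matrix.specialUnitaryGroup (Fin N) ℂ))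
    measurable_re_trace_one_sub (fun V => by rw [re_trace_one_sub (Matrix.mem_specialUnitaryGroup_iff.1 V.2).1]; positivity)
    hβ (c := ν * t / 2) (a := ν * t) (b := t)
    (by linarith) (by nlinarith) hpos
  refine ⟨hz, ?_⟩
  have hsub : ν * t - ν * t / 2 = ν * t / 2 := by ring
  rw [hsub, probReal_univ, mul_one] at hle
  exact hle

/-- **IN PRINT'S REGIME THE LIVE LOSS VANISHES**: for `ν, t > 0` the Laplace error `e^{−βνt∕2} ∕ m → 0` as `β → ∞` (any constant `m`,
e.g. `m = Haar(W_{νt∕2})`). [folklore] -/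
theorem tendsto_laplaceError_atTop {ν t : ℝ} (hν0 : 0 < ν) (ht : 0 < t) (m : ℝ) :
    Tendsto (fun β : ℝ => Real.exp (-(β * (ν * t / 2))) / m) atTop (𝓝 0) := by
  have hc : 0 < ν * t / 2 := by positivity
  have h1 : Tendsto (fun β : ℝ => -(β * (ν * t / 2))) atTop atBot := by
    have : Tendsto (fun β : ℝ => β * (ν * t / 2)) atTop atTop := tendsto_id.atTop_mul_const hc
    exact tendsto_neg_atTop_atBot.comp this
  have h2 : Tendsto (fun β : ℝ => Real.exp (-(β * (ν * t / 2)))) atTop (𝓝 0) := Real.tendsto_exp_atBot.comp h1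
  simpa using h2.div_const m

end SUN

/-! ## §2b The REGION: product Haar on `B → SU(N)`, `S = Σ_b Re tr(1 − v_b)`, window `Π_b W` -/

section Region

variable {N : ℕ} {B : Type*} [Fintype B]

/-- **FUBINI ON THE PRODUCT WINDOW**, all `N`: `∫_{Π_b W_t} e^{−β·S} dκ = z_β(t)^{#B}` for the product Haar `κ` on `B → SU(N)` and
`S(v) = Σ_b Re tr(1 − v_b)` (Mathlib's `restrict_pi_pi` + `integral_fintype_prod_eq_pow`). [folklore] -/
theorem setIntegral_pi_window_eq_pow (β t : ℝ) :
    ∫ v in Set.univ.pi fun _ : B => {V : Matrix.specialUnitaryGroup (Fin N) ℂ | (Matrix.trace (1 - (V : Matrix (Fin N) (Fin N) ℂ))).re ≤ t},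
        Real.exp (-(β * ∑ b, (Matrix.trace (1 - ((v b : Matrix.specialUnitaryGroup (Fin N) ℂ) : Matrix (Fin N) (Fin N) ℂ))).re))
        ∂(Measure.pi fun _ : B => haarProbability (Matrix.specialUnitaryGroup (Fin N) ℂ))
      = (∫ V in {V : Matrix.specialUnitaryGroup (Fin N) ℂ | (Matrix.trace (1 - (V : Matrix (Fin N) (Fin N) ℂ))).re ≤ t},
          Real.exp (-(β * (Matrix.trace (1 - (V : Matrix (Fin N) (Fin N) ℂ))).re)) ∂(haarProbability (Matrix.specialUnitaryGroup (Fin N) ℂ)))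
          ^ Fintype.card B := by
  set μ := haarProbability (Matrix.specialUnitaryGroup (Fin N) ℂ) with hμ
  set g : Matrix.specialUnitaryGroup (Fin N) ℂ → ℝ := fun V => Real.exp (-(β * (Matrix.trace (1 - (V : Matrix (Fin N) (Fin N) ℂ))).re)) with hg
  have hprod : ∀ v : B → Matrix.specialUnitaryGroup (Fin N) ℂ,
      Real.exp (-(β * ∑ b, (Matrix.trace (1 - ((v b : Matrix.specialUnitaryGroup (Fin N) ℂ) : Matrix (Fin N) (Fin N) ℂ))).re))
        = ∏ b, g (v b) := fun v => by
    simp only [hg]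
    rw [← Real.exp_sum]; congr 1; rw [Finset.mul_sum, ← Finset.sum_neg_distrib]
  calc ∫ v in Set.univ.pi fun _ : B => {V : Matrix.specialUnitaryGroup (Fin N) ℂ | (Matrix.trace (1 - (V : Matrix (Fin N) (Fin N) ℂ))).re ≤ t},
        Real.exp (-(β * ∑ b, (Matrix.trace (1 - ((v b : Matrix.specialUnitaryGroup (Fin N) ℂ) : Matrix (Fin N) (Fin N) ℂ))).re)) ∂(Measure.pi fun _ : B => μ)
      = ∫ v in Set.univ.pi fun _ : B => {V : Matrix.specialUnitaryGroup (Fin N) ℂ | (Matrix.trace (1 - (V : Matrix (Fin N) (Fin N) ℂ))).re ≤ t},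
        ∏ b, g (v b) ∂(Measure.pi fun _ : B => μ) := integral_congr_ae (ae_of_all _ fun v => hprod v)
    _ = ∫ v, ∏ b, g (v b) ∂(Measure.pi fun _ : B =>
        μ.restrict {V : Matrix.specialUnitaryGroup (Fin N) ℂ | (Matrix.trace (1 - (V : Matrix (Fin N) (Fin N) ℂ))).re ≤ t}) := by
        rw [Measure.restrict_pi_pi]
    _ = (∫ V, g V ∂(μ.restrict {V : Matrix.specialUnitaryGroup (Fin N) ℂ | (Matrix.trace (1 - (V : Matrix (Fin N) (Fin N) ℂ))).re ≤ t}))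
        ^ Fintype.card B := integral_fintype_prod_eq_pow g
    _ = _ := by simp only [hg]

/-- **THE REGION IN PRINT'S REGIME, ALL `N`**: for `β ≥ 0`, `0 < ν ≤ 1`, `t ≥ 0` and `Haar(W_{νt∕2}) > 0`,
`−log ∫_{Π W_{νt}} e^{−βS} dκ ≤ −log ∫_{Π W_t} e^{−βS} dκ + #B·e^{−βνt∕2}∕Haar_{SU(N)}(W_{νt∕2})` — per plaquette variable an exponentially small
live loss. [folklore] -/
theorem neg_log_windowedBoltzmann_pi_live_le_laplace {β ν t : ℝ} (hβ : 0 ≤ β) (hν0 : 0 < ν) (hν1 : ν ≤ 1) (ht : 0 ≤ t)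
    (hpos : 0 < (haarProbability (Matrix.specialUnitaryGroup (Fin N) ℂ)).real
        {V : Matrix.specialUnitaryGroup (Fin N) ℂ | (Matrix.trace (1 - (V : Matrix (Fin N) (Fin N) ℂ))).re ≤ ν * t / 2}) :
    -Real.log (∫ v in Set.univ.pi fun _ : B => {V : Matrix.specialUnitaryGroup (Fin N) ℂ | (Matrix.trace (1 - (V : Matrix (Fin N) (Fin N) ℂ))).re ≤ ν * t},
        Real.exp (-(β * ∑ b, (Matrix.trace (1 - ((v b : Matrix.specialUnitaryGroup (Fin N) ℂ) : Matrix (Fin N) (Fin N) ℂ))).re))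
        ∂(Measure.pi fun _ : B => haarProbability (Matrix.specialUnitaryGroup (Fin N) ℂ)))
      ≤ -Real.log (∫ v in Set.univ.pi fun _ : B => {V : Matrix.specialUnitaryGroup (Fin N) ℂ | (Matrix.trace (1 - (V : Matrix (Fin N) (Fin N) ℂ))).re ≤ t},
        Real.exp (-(β * ∑ b, (Matrix.trace (1 - ((v b : Matrix.specialUnitaryGroup (Fin N) ℂ) : Matrix (Fin N) (Fin N) ℂ))).re))
        ∂(Measure.pi fun _ : B => haarProbability (Matrix.specialUnitaryGroup (Fin N) ℂ)))
        + (Fintype.card B : ℝ) * (Real.exp (-(β * (ν * t / 2))) / (haarProbability (Matrix.specialUnitaryGroup (Fin N) ℂ)).real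
          {V : Matrix.specialUnitaryGroup (Fin N) ℂ | (Matrix.trace (1 - (V : Matrix (Fin N) (Fin N) ℂ))).re ≤ ν * t / 2}) := by
  obtain ⟨-, hle⟩ := neg_log_windowedBoltzmann_live_le_laplace (N := N) hβ hν0 hν1 ht hpos
  rw [setIntegral_pi_window_eq_pow, setIntegral_pi_window_eq_pow, Real.log_pow, Real.log_pow]
  have hn : (0 : ℝ) ≤ Fintype.card B := Nat.cast_nonneg _
  have := mul_le_mul_of_nonneg_left hle hn
  linarith

end Region

/-! ## §3 Sanity -/

/-- At `ν = 1` the live and the unlowered restricted integrals coincide (`1·t = t`). -/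
example {N : ℕ} (β t : ℝ) :
    ∫ V in {V : Matrix.specialUnitaryGroup (Fin N) ℂ | (Matrix.trace (1 - (V : Matrix (Fin N) (Fin N) ℂ))).re ≤ 1 * t},
        Real.exp (-(β * (Matrix.trace (1 - (V : Matrix (Fin N) (Fin N) ℂ))).re)) ∂(haarProbability (Matrix.specialUnitaryGroup (Fin N) ℂ))
      = ∫ V in {V : Matrix.specialUnitaryGroup (Fin N) ℂ | (Matrix.trace (1 - (V : Matrix (Fin N) (Fin N) ℂ))).re ≤ t},
        Real.exp (-(β * (Matrix.trace (1 - (V : Matrix (Fin N) (Fin N) ℂ))).re)) ∂(haarProbability (Matrix.specialUnitaryGroup (Fin N) ℂ)) := by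
  rw [one_mul]

end Summit.QuantumFields.BalabanUV.T4Continuum.Spine.NE7c.LiveFactorWindowLaplace

end
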